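import Summits.FinalStateConjecture.FinalStateConjecture.Theorems.PhotonSphereChannelsTameCensorshipReduction
import Summits.FinalStateConjecture.FinalStateConjecture.Theorems.ZeroEnergyKerrOrBombOneLockedExplosionDefs
import HarnessLib

/-!
# Route ZeroEnergyKerrOrBomb · crux `StationaryLimitReduction`, line `one-locked-explosion`:
# stub `stub_localEscapeSuffices` (local escape suffices for Christodoulou curve-genericity)

Stub `stub_localEscapeSuffices` of the line skeleton
`Cruxes/StationaryLimitReduction/Lines/one-locked-explosion.lean` (crux
stmt-FinalStateConjecture-10021, `ZeroEnergyKerrOrBomb.StationaryLimitReduction :=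
KerrOrBomb → FinalStateConjecture`): the reparametrisation lemma applied first in the composition
`StationaryLimitReduction_of`.

Christodoulou curve-genericity `InitialDataSet.IsChristodoulouGeneric 𝓓 P 1` asks, through every
admissible datum `d ∈ 𝓓` failing `P`, for an admissible, jointly smooth, injective one-parameter
family `F : ℝ¹ → InitialDataSet` with `F 0 = d` ALL of whose members with parameter `c ≠ 0`
satisfy `P`. The line's `HasLocalEscape 𝓓 P d` only asks this for `0 < ‖c‖ < ε`. The tree theorem
`PhotonSphereChannels.isChristodoulouGeneric_one_of_local`
(`Theorems/PhotonSphereChannelsTameCensorshipReduction.lean` §3: squash `ℝ¹` smoothly and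
injectively into the parameter interval `|c₀| < ε`) reduces the global form to a local one stated
with `|c 0| < ε`; the only remaining step is `‖c‖ = |c 0|` on `EuclideanSpace ℝ (Fin 1)`.

No named facts; Mathlib + the tree theorem only.
-/

-- every `Summit.FinalStateConjecture.FinalStateConjecture.…` name repeats the summit = sub-problem segment (D-0017 layout)
set_option linter.dupNamespace false

noncomputable section

open scoped Manifold ContDiff

namespace Summit.FinalStateConjecture.FinalStateConjecture.Theorems.OneLockedExplosion

open Literature.Geometry.Lorentzian


/-- The norm on `ℝ¹ = EuclideanSpace ℝ (Fin 1)` is the absolute value of the single coordinate: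
`‖c‖ = √(‖c 0‖ ²) = |c 0|`. [folklore] -/
private theorem norm_euclideanOne_eq_abs (c : EuclideanSpace ℝ (Fin 1)) : ‖c‖ = |c 0| := by
  rw [EuclideanSpace.norm_eq, Fin.sum_univ_one, Real.norm_eq_abs, sq_abs, Real.sqrt_sq_eq_abs]

/-- **Local escape suffices for Christodoulou curve-genericity (codimension `1`).** If through every
admissible datum `d ∈ 𝓓` failing `P` there is a local escape `HasLocalEscape 𝓓 P d` — an
admissible, jointly smooth, injective curve `F` through `d` whose members are good for
`0 < ‖c‖ < ε` — then `P` is Christodoulou-generic in `𝓓` with codimension `1`: reparametrise `ℝ¹`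
into the parameter interval `|c 0| < ε` (`PhotonSphereChannels.isChristodoulouGeneric_one_of_local`),
using `‖c‖ = |c 0|` on `ℝ¹`. [cite: Christodoulou1999, p. A24] -/
theorem stub_localEscapeSuffices :
    ∀ (X : Type) [TopologicalSpace X] [ChartedSpace E3 X] [IsManifold (𝓡 3) ∞ X]
      (𝓓 : Set (InitialDataSet (𝓡 3) X)) (P : InitialDataSet (𝓡 3) X → Prop),
      (∀ d ∈ 𝓓, ¬ P d → HasLocalEscape 𝓓 P d) →
        InitialDataSet.IsChristodoulouGeneric 𝓓 P 1 := by
  intro X _ _ _ 𝓓 P h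
  refine PhotonSphereChannels.isChristodoulouGeneric_one_of_local fun d hd hPd ↦ ?_
  obtain ⟨F, hF, h0, hinj, hadm, ε, hε, hP⟩ := h d hd hPd
  exact ⟨ε, F, hε, hF, h0, fun c c' _ _ hcc' ↦ hinj hcc', fun c _ ↦ hadm c,
    fun c hc hcε ↦ hP c hc ((norm_euclideanOne_eq_abs c).trans_lt hcε)⟩

end Summit.FinalStateConjecture.FinalStateConjecture.Theorems.OneLockedExplosion

end
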